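import Literature.MathematicalPhysics.QuantumFieldTheory.Balaban1983to89.B9Eq319QprimeLipschitz

/-!
# `Balaban1983to89.B9Eq319QprimeBlockLocal` — T. Bałaban, *Propagators for lattice gauge theories in a background field*, Commun. Math. Phys.
# **99** (1985) 389–434 [Balaban1985BackgroundPropagators] (3.19) p. 393 with p. 403; [Balaban1984PropagatorsI] (1.7) p. 18; [Balaban1985Averaging]
# (2) p. 17: THE ONE-STEP AVERAGING `(Q′(U)λ)(y)` READS THE BACKGROUND ON THE BONDS OF THE BLOCK `B(y)` ONLY — the contour `Γ_{y,x}` of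
# [B5] (1.7) stays inside `B(y)` — HENCE THE (ρ′) LETTER `‖(Q′(U)λ)(y) − (Q′(1)λ)(y)‖ ≤ ρ′·L^{−d}Σ_{x∈B(y)}‖λ(x)‖` HOLDS AT THE BLOCK `y`
# AS SOON AS THE INTERNAL BONDS OF `B(y)` ARE `ε`-CLOSE TO THE IDENTITY (nothing assumed on any other bond)

statement-level skeleton of published theorems with citation tags; proofs where landed; nothing here is a claim
about the Yang–Mills mass gap

PDF held: `paper:balaban1985-cmp99-background-propagators` (journal page = PDF page + 388); (3.19) p. 393 and p. 403 through the verbatim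
quotations of `B9Eq319QprimeTorus` ∕ `B9Eq319QprimeLipschitz` (this lineage, gen 57); [B5] (1.7) p. 18 as quoted in `B9Eq319QprimeTorus`.

THE PRINT.  [B9] (3.19) p. 393: *«(Q′(V)λ)(y) = Σ_{x∈B(y)} L^{−d}R(V(Γ_{y,x}))λ(x)»*; [B5] (1.7) p. 18: *«Γ_{y,x} = [y, (y₁, …, y_{d−1}, x_d)] ∪ … ∪
[(y₁, x₂, …, x_d), x]»* — the broken line from the block corner `y` to `x ∈ B(y)`, which never leaves `B(y)`; [B9] p. 416 (Thm 3.11, proof):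
*«positivity of the operators G_□ … Doing the gauge transformation we get U = e^{iηA} with A small»* — print works CUBE BY CUBE, so the letters of
the site operator must be read locally; p. 403: the operators at `U` *«satisfy the same bounds»*.

WHY THIS FILE (cell context).  ROUTES-NE9 v13.21 §L1.2 l.413 (v)∕(x) «the PLAQUETTE-CLASS upgrade of (I1)» (offered to this lineage first): the
strong coercivity of the site operator `Δ′_{a′}(U)` (`B9Thm311SitePrimeFormCoercive[Canonical]`, (I1-scaled)) is to be moved from the GLOBAL
small-bond window to print's class (3.35) (small plaquette variables, a small gauge PER CUBE).  The sequel `B9Thm311SitePrimeFormCoerciveBlockGauge`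
does it block by block in the block's own axial gauge; it needs the (ρ′) letter of `B9Eq319QprimeLipschitz` AT ONE BLOCK from the closeness of
THAT BLOCK's internal bonds only — the gen-57 file assumes the closeness on every bond of the lattice.  This file localises it.

WHAT IS PROVED (sorry-free; 0 `def`; [folklore] finite-lattice bookkeeping; no inequality of the paper asserted).
* §1 **`blockCoord_segSite`**, **`blockCoord_eq_of_mem_contour`** — every site of the contour `Γ_{y,x}` lies in the block of `x` ([B5] (1.7)).
* §2 (private `isChain_and_of_forall`: a chain all of whose members satisfy `P` is a chain for `S ∧ P ∧ P`), **`isChain_block_centre_cons_contour`** — the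
  contour is a chain of forward unit bonds INTERNAL to `B(blockCoord x)`; **`norm_pathTr_cons_sub_le_of_chain`** — the telescoping of
  `B9Eq319QprimeLipschitz.norm_pathTr_cons_sub_le` with the step hypothesis asked only along an `S`-chain.
* §3 **`norm_QprimeLin_sub_flat_apply_le_local`** — `‖(Q′(R)λ)(y) − (Q′(1)λ)(y)‖ ≤ ((1+ε)^{d(L−1)} − 1)·L^{−d}·Σ_{x∈B(y)}‖λ(x)‖` assuming
  `‖R(b)v − v‖ ≤ ε‖v‖` for the bonds `b = (x, μ)` with `x, x+e_μ ∈ B(y)` ONLY; **`norm_QprimeW_sub_flat_apply_le_local`** — the same on the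
  NE9 chain's `QprimeW L m φ U` (`L²` carrier), flat companion `QprimeW L m φ 1`.
MODEL ∕ DECLARED READINGS.  (M1) as `B9Eq319QprimeTorus` (one averaging step on `Π_i ℤ/(L·m_i)ℤ`, blocks B7 (2), contours [B5] (1.7), weight
`L^{−d}`); (M2) the closeness `ε` is a DISPLAYED letter on the internal bonds of one block; (M3) finite-lattice constant `ρ′(ε)` as in the parent.
HONEST SCOPE.  [folklore] combinatorics of the block contours; NOT [B9] Thm 3.11, NOT summit progress (cell pub-balaban: NE9 NOT PRINTED ∕ NOT
PROVED; «NE9 ⇐ the named binders»; spine PROVED 0/9; HONEST DEPENDENCY: continuum YM on T⁴ ⇐ BetaPertH ∧ nine spine estimates (0/9 proved);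
BetaPertH ⇐ (D1) ∧ (D4) ∧ CAP+tail; G-an2-4 gates asym, D1 and NE2/3/4).  Unit `b2b-balaban-t4-ne9-formalise-leaf-03` (NE9 crux-team leaf prover,
gen 63), INTENT I-ne9leaf03-g63-1 part (P0); NEW file importing `B9Eq319QprimeLipschitz` only; modifies nothing.  Net new unproved facts: 0.
-/

noncomputable section

open scoped BigOperators

namespace Literature.MathematicalPhysics.QuantumFieldTheory.Balaban1983to89.B9Eq319QprimeBlockLocal

open B4Sect5Torus (TSite)
open B9SectCLatticeCarrier (Bond shift)
open B9Eq323Ker (pathTr)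
open B9Eq319QprimeTorus (fineP centre blockCoord offset segSite contour stepTransport QprimeLin QprimeLin_apply Qprime
  mem_blockOf_iff blockCoord_centre isChain_centre_cons_contour)
open B9Eq311L2Pairing (WL2)
open B11Eq103H1Complex (SiteL2K)
open B9Eq310HessianOperator (adTransportW)
open B9Eq326OperatorAssembly (QprimeW)
open B5Eq172HodgePositivity (adTransportW_one)
open B9Eq319QprimeLipschitz (QprimeLin_flat_apply rho_nonneg length_contour_le)

variable {d : ℕ} (L : ℕ) [NeZero L] (m : Fin d → ℕ)

/-! ## §1 The contour `Γ_{y,x}` stays in the block `B(y)` -/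

/-- **Every site of the `κ`-segment of `Γ_{y,x}` lies in the block of `x`**: its coordinates are `x_i` (`i > κ`), `L·(x_κ div L) + t + 1` with
`t + 1 ≤ x_κ mod L < L`, and the corner values `L·(x_i div L)` (`i < κ`) — all with the same quotient by `L`. [cite: Balaban1984PropagatorsI, (1.7) p.18; Balaban1985Averaging, (2) p.17] -/
theorem blockCoord_segSite (x : TSite d (fineP L m)) (κ : Fin d) (t : Fin (offset L m x κ)) :
    blockCoord L m (segSite L m x κ t) = blockCoord L m x := by
  have hL : 0 < L := Nat.pos_of_ne_zero (NeZero.ne L)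
  funext i
  apply Fin.ext
  simp only [B9Eq319QprimeTorus.blockCoord_apply_val]
  unfold segSite
  by_cases h1 : κ < i
  · simp only [h1, if_true]
  · simp only [h1, if_false]
    by_cases h2 : i = κ
    · simp only [h2, dite_true]
      subst h2
      have ht : (t : ℕ) + 1 < L := lt_of_le_of_lt (Nat.succ_le_of_lt t.isLt) (B9Eq319QprimeTorus.offset_lt L m x i)
      rw [Nat.mul_add_div hL, Nat.div_eq_of_lt ht, add_zero]
    · simp only [h2, dite_false]
      rw [Nat.mul_div_right _ hL]

/-- **The contour never leaves the block**: `z ∈ Γ_{y,x} ⇒ z ∈ B(blockCoord x)`. [cite: Balaban1984PropagatorsI, (1.7) p.18; Balaban1985BackgroundPropagators, (3.19) p.393] -/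
theorem blockCoord_eq_of_mem_contour {x z : TSite d (fineP L m)} (hz : z ∈ contour L m x) : blockCoord L m z = blockCoord L m x := by
  unfold contour at hz
  simp only [List.mem_flatMap, List.mem_reverse, List.mem_finRange, List.mem_map, true_and] at hz
  obtain ⟨κ, t, rfl⟩ := hz
  exact blockCoord_segSite L m x κ t

/-! ## §2 The contour as a chain of INTERNAL forward bonds; telescoping along a chain -/

omit [NeZero L] in
/-- [folklore] A chain all of whose members satisfy `P` is a chain for the relation `S a b ∧ P a ∧ P b` (private list helper). -/
private theorem isChain_and_of_forall {α : Type*} {S : α → α → Prop} {P : α → Prop} :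
    ∀ {l : List α}, List.IsChain S l → (∀ z ∈ l, P z) → List.IsChain (fun a b => S a b ∧ P a ∧ P b) l
  | [], _, _ => List.IsChain.nil
  | [a], _, _ => List.isChain_singleton a
  | a :: b :: rest, hc, hP => by
    rw [List.isChain_cons_cons] at hc ⊢
    exact ⟨⟨hc.1, hP a (by simp), hP b (by simp)⟩, isChain_and_of_forall hc.2 fun z hz => hP z (List.mem_cons_of_mem a hz)⟩

/-- **`centre (blockCoord x) :: Γ_{y,x}` IS A CHAIN OF FORWARD UNIT BONDS INTERNAL TO `B(blockCoord x)`** (both endpoints of every step in the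
block). [cite: Balaban1984PropagatorsI, (1.7) p.18; Balaban1985Averaging, (2) p.17] -/
theorem isChain_block_centre_cons_contour (x : TSite d (fineP L m)) :
    List.IsChain (fun a b : TSite d (fineP L m) => (∃ μ : Fin d, b = shift μ a) ∧ blockCoord L m a = blockCoord L m x ∧
      blockCoord L m b = blockCoord L m x) (centre L m (blockCoord L m x) :: contour L m x) :=
  isChain_and_of_forall (isChain_centre_cons_contour L m x) fun z hz => by
    rcases List.mem_cons.1 hz with rfl | hz
    · exact blockCoord_centre L m _
    · exact blockCoord_eq_of_mem_contour L m hz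

section PathTransport

variable {X : Type*} {V : Type*} [NormedAddCommGroup V] [NormedSpace ℝ V]

/-- **TELESCOPING ALONG A CHAIN** ([B7] (9): `U(Γ) = Π U(x_i, x_{i+1})`): if the step transporter of every `S`-admissible step satisfies
`‖τ(x,x′)v − v‖ ≤ ε‖v‖`, then along an `S`-chain `x :: p` the transport satisfies `‖R(V(Γ))v − v‖ ≤ ((1 + ε)^{|Γ|} − 1)‖v‖` — the parent's
`norm_pathTr_cons_sub_le` with the hypothesis asked on the path only. [cite: Balaban1985Averaging, (9) p.18] -/
theorem norm_pathTr_cons_sub_le_of_chain {τ : X → X → V →ₗ[ℝ] V} {ε : ℝ} (hε : 0 ≤ ε) {S : X → X → Prop}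
    (hτ : ∀ x x', S x x' → ∀ v, ‖τ x x' v - v‖ ≤ ε * ‖v‖) :
    ∀ (p : List X) (x : X), List.IsChain S (x :: p) → ∀ v : V, ‖pathTr τ (x :: p) v - v‖ ≤ ((1 + ε) ^ p.length - 1) * ‖v‖
  | [], x, _, v => by simp [B9Eq323Ker.pathTr_singleton]
  | x' :: rest, x, hc, v => by
    have hxx' : S x x' := (List.isChain_cons_cons.1 hc).1
    have ih := norm_pathTr_cons_sub_le_of_chain hε hτ rest x' (List.isChain_cons_cons.1 hc).2 v
    have hpow : 0 ≤ (1 + ε) ^ rest.length - 1 := by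
      have : (1 : ℝ) ≤ (1 + ε) ^ rest.length := one_le_pow₀ (by linarith)
      linarith
    rw [B9Eq323Ker.pathTr_cons_cons, LinearMap.comp_apply, List.length_cons, pow_succ]
    set w := pathTr τ (x' :: rest) v with hw
    calc ‖τ x x' w - v‖ ≤ ‖τ x x' w - w‖ + ‖w - v‖ := norm_sub_le_norm_sub_add_norm_sub _ _ _
      _ ≤ ε * ‖w‖ + ‖w - v‖ := by gcongr; exact hτ x x' hxx' w
      _ ≤ ε * (‖v‖ + ‖w - v‖) + ‖w - v‖ := by gcongr; exact norm_le_insert' w v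
      _ = (1 + ε) * ‖w - v‖ + ε * ‖v‖ := by ring
      _ ≤ (1 + ε) * (((1 + ε) ^ rest.length - 1) * ‖v‖) + ε * ‖v‖ := by gcongr
      _ = ((1 + ε) ^ rest.length * (1 + ε) - 1) * ‖v‖ := by ring

end PathTransport

/-! ## §3 (ρ′) at ONE block from the closeness of ITS internal bonds -/

section Local

variable {V : Type*} [NormedAddCommGroup V] [NormedSpace ℂ V]

/-- **(ρ′), POINTWISE BLOCK FORM, LOCAL HYPOTHESIS**: if the `ℂ`-linear bond transporters of the INTERNAL bonds of `B(y)` (`b = (x, μ)` with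
`x ∈ B(y)` and `x + e_μ ∈ B(y)`) are `ε`-close to the identity, then `‖(Q′(R)λ)(y) − (Q′(1)λ)(y)‖ ≤ ((1 + ε)^{d(L−1)} − 1)·L^{−d}·Σ_{x∈B(y)} ‖λ(x)‖` —
each term of (3.19) is transported along a contour of at most `d(L−1)` INTERNAL bonds (§1–§2); no hypothesis on any other bond.
[cite: Balaban1985BackgroundPropagators, (3.19) p.393, p.403, p.416] -/
theorem norm_QprimeLin_sub_flat_apply_le_local (Rb : Bond d (fineP L m) → V →ₗ[ℂ] V) {ε : ℝ} (hε : 0 ≤ ε) (y : TSite d m)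
    (hR : ∀ (x : TSite d (fineP L m)) (μ : Fin d), blockCoord L m x = y → blockCoord L m (shift μ x) = y → ∀ v, ‖Rb (x, μ) v - v‖ ≤ ε * ‖v‖)
    (l : TSite d (fineP L m) → V) :
    ‖QprimeLin L m Rb l y - QprimeLin L m (fun _ => LinearMap.id) l y‖ ≤
      ((1 + ε) ^ (d * (L - 1)) - 1) * (((L : ℝ) ^ d)⁻¹ * ∑ x ∈ B9Eq319QprimeTorus.blockOf L m y, ‖l x‖) := by
  have hρ := rho_nonneg L (d := d) hε
  have hw : 0 ≤ ((L : ℝ) ^ d)⁻¹ := by positivity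
  rw [QprimeLin_flat_apply, QprimeLin_apply, Qprime, B9Eq323Ker.avgQ, ← Finset.sum_sub_distrib, Finset.mul_sum, Finset.mul_sum]
  refine (norm_sum_le _ _).trans (Finset.sum_le_sum fun x hx => ?_)
  have hxy : blockCoord L m x = y := (mem_blockOf_iff L m y x).1 hx
  rw [B9Eq319QprimeTorus.weight, ← smul_sub, norm_smul, norm_inv, norm_pow, Real.norm_natCast]
  -- the step transporters along the internal steps of `B(y)` are `ε`-close to the identity
  have hstep : ∀ a b : TSite d (fineP L m), ((∃ μ : Fin d, b = shift μ a) ∧ blockCoord L m a = y ∧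
      blockCoord L m b = y) → ∀ v : V, ‖stepTransport L m (fun b => (Rb b).restrictScalars ℝ) a b v - v‖ ≤ ε * ‖v‖ := by
    rintro a b ⟨h, ha, hb⟩ v
    unfold stepTransport
    rw [dif_pos h, LinearMap.restrictScalars_apply]
    have hb' : blockCoord L m (shift h.choose a) = y := by rw [← h.choose_spec, hb]
    exact hR a h.choose ha hb' v
  have hchain := isChain_block_centre_cons_contour L m x
  rw [hxy] at hchain
  have h1 := norm_pathTr_cons_sub_le_of_chain hε hstep (contour L m x) (centre L m y) hchain (l x)
  have h2 : (1 + ε) ^ (contour L m x).length - 1 ≤ (1 + ε) ^ (d * (L - 1)) - 1 :=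
    sub_le_sub_right (pow_le_pow_right₀ (by linarith) (length_contour_le L m x)) 1
  calc ((L : ℝ) ^ d)⁻¹ * ‖pathTr (stepTransport L m fun b => (Rb b).restrictScalars ℝ) (centre L m y :: contour L m x) (l x) - l x‖
      ≤ ((L : ℝ) ^ d)⁻¹ * (((1 + ε) ^ (d * (L - 1)) - 1) * ‖l x‖) := by
        refine mul_le_mul_of_nonneg_left (h1.trans ?_) hw
        exact mul_le_mul_of_nonneg_right h2 (norm_nonneg _)
    _ = ((1 + ε) ^ (d * (L - 1)) - 1) * (((L : ℝ) ^ d)⁻¹ * ‖l x‖) := by ring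

end Local

/-! ## §4 The same on the NE9 chain's `QprimeW` (`L²` carrier) -/

section LocalW

variable {𝔸 : Type*} [Ring 𝔸] [Algebra ℂ 𝔸] {W : Type*} [NormedAddCommGroup W] [InnerProductSpace ℂ W] (φ : W ≃ₗ[ℂ] 𝔸) {c₀ : ℝ}
  (U : Bond d (fineP L m) → 𝔸ˣ)

/-- **(ρ′) ON THE `L²` CARRIER AT ONE BLOCK, LOCAL HYPOTHESIS**: if the transporters `R(U(b))` of the INTERNAL bonds of `B(y)` are `ε`-close to the
identity on the fibre, then `‖(Q′(U)λ)(y) − (Q′(1)λ)(y)‖ ≤ ((1 + ε)^{d(L−1)} − 1)·L^{−d}·Σ_{x∈B(y)} ‖λ(x)‖` — the letter the per-block gauge argument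
of `B9Thm311SitePrimeFormCoerciveBlockGauge` consumes (there `U` is the block's gauged field, small on `B(y)` and arbitrary elsewhere).
[cite: Balaban1985BackgroundPropagators, (3.19) p.393, p.403, Thm 3.11 p.416] -/
theorem norm_QprimeW_sub_flat_apply_le_local {ε : ℝ} (hε : 0 ≤ ε) (y : TSite d m)
    (hR : ∀ (x : TSite d (fineP L m)) (μ : Fin d), blockCoord L m x = y → blockCoord L m (shift μ x) = y →
      ∀ w, ‖adTransportW φ U (x, μ) w - w‖ ≤ ε * ‖w‖)
    (lam : SiteL2K ℂ d (fineP L m) c₀ W) :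
    ‖QprimeW L m φ U (c₀ := c₀) lam y - QprimeW L m φ (fun _ => 1) (c₀ := c₀) lam y‖ ≤
      ((1 + ε) ^ (d * (L - 1)) - 1) *
        (((L : ℝ) ^ d)⁻¹ * ∑ x ∈ B9Eq319QprimeTorus.blockOf L m y, ‖(WL2.linearEquiv ℂ ℂ (fun _ : TSite d (fineP L m) => c₀) lam) x‖) := by
  have h1 : adTransportW φ (fun _ : Bond d (fineP L m) => (1 : 𝔸ˣ)) = fun _ => LinearMap.id := funext (adTransportW_one φ)
  rw [QprimeW, QprimeW, LinearMap.comp_apply, LinearMap.comp_apply, h1]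
  exact norm_QprimeLin_sub_flat_apply_le_local L m (adTransportW φ U) hε y hR _

end LocalW

end Literature.MathematicalPhysics.QuantumFieldTheory.Balaban1983to89.B9Eq319QprimeBlockLocal

end
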